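import Mathlib

/-!
# Venture HSemireg — MOD-4 OFF THE SPLIT FAMILY: the numeric core of THEOREM A_{2n} (no totally semiregular O_Z-type
# object on a Weil `2n`-fold, `n` even ≥ 4): `e_n < C(2n, n)` where `e_n = 2·(C(2n−2, n−1) + n + 1)` is the generic
# carrier Euler number of THEOREM R_Z (seat `w3-mod4-1` g4, files of record `widen/W3/MOD4-OFFSPLIT-w3mod4.md` v1.5.1
# §10.2 (C1)/(C6), §10.4 (A), `widen/W3/MOD4-OFFSPLIT-THEOREMS-w3mod4.md` v1.4.7)

HONEST FRAMING. Lean index of the computation cell `pub-hsemireg`, widening seat `w3-mod4-1`.  ONE ELEMENTARY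
INEQUALITY BETWEEN BINOMIAL COEFFICIENTS, nothing else: no abelian variety, no sheaf, no Ext group, no semiregularity map.
On paper: for an O_Z-type class-exact Mukai vector `v = q_n hⁿ/n! + w + (higher)` on a Weil `2n`-fold, total
semiregularity would force `(w,w)_χ = R_v(−1) − C(2n,n)·D·q_n²` with `R_v(−1) ≤ e_n := 2·(C(2n−2,n−1) + n + 1)` when `n`
is even (THEOREM R_Z / (C6)), while Hodge–Riemann gives `(w,w)_χ > 0` and `D q_n² ≥ 1`; so THEOREM A_{2n} reduces to
`e_n < C(2n,n)` for `n ≥ 4`, which is the statement below (with `n = m + 1`, `C(2m,m) = centralBinom m`).  The bound is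
sharp in the sense that it fails at `n = 2` (`e_2 = 10 > 6`), where the fourfold pin has solutions.
Nothing here says that HC, HC_CM or HC_AV holds.

CONTENT (all PROVED, 0 sorry), namespace `Summit.Ventures.HSemireg.Mod4`:
* `succ_mul_succ_lt_mul_centralBinom` — `(m+1)(m+2) < m · centralBinom m` for `m ≥ 3`;
* `carrierEuler_lt_centralBinom` — `2·(centralBinom m + m + 2) < centralBinom (m+1)` for `m ≥ 3`;
* `carrierEuler_lt_choose` — the same as `2·(C(2n−2,n−1) + n + 1) < C(2n,n)` for `n ≥ 4`.
-/

namespace Summit.Ventures.HSemireg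

namespace Mod4

open Nat

/-- `(m+1)(m+2) < m · C(2m,m)` for `m ≥ 3` (induction; the step uses `(m+1)·C(2m+2,m+1) = 2(2m+1)·C(2m,m)`). -/
theorem succ_mul_succ_lt_mul_centralBinom (m : ℕ) (hm : 3 ≤ m) :
    (m + 1) * (m + 2) < m * centralBinom m := by
  induction m, hm using Nat.le_induction with
  | base => decide
  | succ k hk ih =>
    have hrec := Nat.succ_mul_centralBinom_succ k
    have key : k * ((k + 1 + 1) * (k + 1 + 2)) < k * ((k + 1) * centralBinom (k + 1)) := by
      have h1 : k * ((k + 1) * centralBinom (k + 1)) = 2 * (2 * k + 1) * (k * centralBinom k) := by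
        rw [hrec]; ring
      rw [h1]
      have ih' : (k + 1) * (k + 2) + 1 ≤ k * centralBinom k := ih
      have hpoly : k * ((k + 1 + 1) * (k + 1 + 2)) < 2 * (2 * k + 1) * ((k + 1) * (k + 2) + 1) := by
        have e : 2 * (2 * k + 1) * ((k + 1) * (k + 2) + 1) =
            k * ((k + 1 + 1) * (k + 1 + 2)) + (3 * k ^ 3 + 9 * k ^ 2 + 12 * k + 6) := by ring
        rw [e]; omega
      calc k * ((k + 1 + 1) * (k + 1 + 2)) < 2 * (2 * k + 1) * ((k + 1) * (k + 2) + 1) := hpoly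
        _ ≤ 2 * (2 * k + 1) * (k * centralBinom k) := Nat.mul_le_mul_left _ ih'
    exact Nat.lt_of_mul_lt_mul_left key

/-- **Numeric core of THEOREM A_{2n}** (`n = m + 1 ≥ 4`): `2·(C(2m,m) + m + 2) < C(2m+2,m+1)`. -/
theorem carrierEuler_lt_centralBinom (m : ℕ) (hm : 3 ≤ m) :
    2 * (centralBinom m + m + 2) < centralBinom (m + 1) := by
  have h := succ_mul_succ_lt_mul_centralBinom m hm
  have hrec := Nat.succ_mul_centralBinom_succ m
  have key : (m + 1) * (2 * (centralBinom m + m + 2)) < (m + 1) * centralBinom (m + 1) := by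
    rw [hrec]
    -- (m+1)·2(C + m + 2) = 2(m+1)C + 2(m+1)(m+2) < 2(m+1)C + 2mC = 2(2m+1)C
    have e1 : (m + 1) * (2 * (centralBinom m + m + 2)) = 2 * ((m + 1) * centralBinom m) + 2 * ((m + 1) * (m + 2)) := by ring
    have e2 : 2 * (2 * m + 1) * centralBinom m = 2 * ((m + 1) * centralBinom m) + 2 * (m * centralBinom m) := by ring
    rw [e1, e2]
    omega
  exact Nat.lt_of_mul_lt_mul_left key

/-- The same inequality in the notation of the files of record: `e_n = 2·(C(2n−2,n−1) + n + 1) < C(2n,n)` for `n ≥ 4`. -/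
theorem carrierEuler_lt_choose (n : ℕ) (hn : 4 ≤ n) :
    2 * ((2 * n - 2).choose (n - 1) + n + 1) < (2 * n).choose n := by
  obtain ⟨m, rfl⟩ : ∃ m, n = m + 1 := ⟨n - 1, by omega⟩
  have hm : 3 ≤ m := by omega
  have h := carrierEuler_lt_centralBinom m hm
  rw [centralBinom_eq_two_mul_choose, centralBinom_eq_two_mul_choose] at h
  have e1 : 2 * (m + 1) - 2 = 2 * m := by omega
  have e2 : m + 1 - 1 = m := by omega
  rw [e1, e2]
  have e3 : (2 * m).choose m + (m + 1) + 1 = (2 * m).choose m + m + 2 := by ring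
  rw [e3]
  exact h

/-- Sanity `example`s: `n = 4`: `e_4 = 50 < 70`; `n = 6`: `518 < 924`. -/
example : 2 * ((2 * 4 - 2).choose (4 - 1) + 4 + 1) = 50 ∧ (2 * 4).choose 4 = 70 := by decide
example : 2 * ((2 * 6 - 2).choose (6 - 1) + 6 + 1) = 518 ∧ (2 * 6).choose 6 = 924 := by decide

end Mod4

end Summit.Ventures.HSemireg
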